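import Summits.AtomisticToContinuum.Crystallization.Theorems.FrustratedLawDichotomyThickeningField
import Literature.Probability.Process.PointStationaryTransfer

/-!
# FrustratedLawDichotomy · crux `AperiodicFrustratedLawGap` (stmt-AtomisticToContinuum-27623) — COVARIANT THICKENING OF LAWS, part 4:
# THE POINTWISE VACANCY FLOOR OF A MINIMISING LAW — no hole deeper than `e⋆` (up to the anchor's short-range repulsion)
# (decomp-a2c, prover hand 2, structural share, generation 4)

`vacancyFloor_of_minimising`: granted the floor of item 9229, for a MINIMISING point-stationary `δ`-hard-core probability law `P`
(`E_P[rootEnergy] ≤ e⋆`), every offset `u : ℝ³` and every vacancy radius `s > 0`, ALMOST SURELY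

  `μ(B(u, s)) = 0  ⟹  e⋆ ≤ Φ_μ(u) + ½ R(μ)`,   `Φ_μ(u) = Σ_{q ∈ μ} V_LJ(‖q − u‖)`,  `R(μ) = Σ_{q ∈ μ} V_LJ⁺(‖q‖)`

— the Lennard-Jones field at an `s`-vacant site `u` (seen from the root) is at least `e⋆` minus half the root's SHORT-RANGE REPULSION `R(μ)`
(`V_LJ⁺ = max(V_LJ, 0)` vanishes beyond `2^{-1/6} ≈ 0.891`, so `R(μ) = 0` unless the root has a compressed bond).  Proof: apply the symmetrised
insertion price `meanField_ge_of_minimising` to the pattern `A = {μ : μ(B(u,s)) = 0, Φ_μ(u) + ½R(μ) < e⋆}` (vacant AND deep): the mutual energy of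
the pattern atoms is at most `R`, so `P(A)·e⋆ ≤ ∫_A (Φ + ½R) dP < P(A)·e⋆` unless `P(A) = 0`.

`ae_forall_vacancyFloor_of_minimising` transfers it to EVERY ATOM as anchor (Aldous–Lyons «everything shows at the root»,
`IsPointStationaryLaw.ae_forall_map_sub`), simultaneously for all rational offsets and radii.  Read this way it says: in almost every configuration of a minimising law, EVERY vacant
site `z` has `Φ_μ(z) ≥ e⋆ − ½ inf_p R_p(μ)` over all anchoring atoms `p` — in particular `Φ_μ(z) ≥ e⋆ ≈ −0.7175` at every hole as soon as ONE
atom of the configuration has no neighbour closer than `2^{-1/6}`; a vacancy of a close-packed matrix (`Φ ≈ 2e(fcc) ≈ −1.43`) is excluded.  This is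
the `k = 1` insertion half of Sütő's `e⋆`-μGSC property of minimising laws, obtained here self-containedly on the `FrustratedLawDichotomy` side
(the tree's `EquilibriumInLaw.stub_equilibriumInLaw` module chain being unbuilt on the farm at the time of writing).  All `[folklore]`.
-/

noncomputable section

namespace Summit.AtomisticToContinuum.Crystallization.Theorems.FrustratedLawDichotomyThickening

open MeasureTheory Metric Set Filter ProbabilityTheory
open scoped ENNReal Topology BigOperators
open Literature.MathematicalPhysics.StatisticalMechanics Literature.Probability.Process
open Summit.AtomisticToContinuum.Crystallization.Theorems.ChargedEnergyGapNegative (E3 eStar)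
open Summit.AtomisticToContinuum.Crystallization.Theorems.FrustratedLawDichotomyFiniteClusterGap
  (measurable_ofReal_lennardJones_parts integrable_rootEnergy_of_ae_hardCore)
open Literature.Probability.Process.LocalConfig (finite_inter_of_separated)

variable {δ : ℝ} {P : Measure (Measure E3)}

/-- The vacancy pattern is inherited covariantly: if `θ_p μ` has no atom in `B(u, s)` then every atom `q` of `μ` is at distance `≥ s` from
`p + u`. [folklore] -/
theorem le_dist_of_vacant {μ : Measure E3} (hμ : IsRootedHardCore δ μ) {u : E3} {s : ℝ} {p q : E3} (hq : μ {q} ≠ 0)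
    (hvac : (μ.map fun x : E3 => x - p) (ball u s) = 0) : s ≤ dist q (p + u) := by
  obtain ⟨S, -, -, rfl⟩ := hμ
  have hqS : q ∈ S := (count_restrict_singleton_ne_zero_iff S q).1 hq
  rw [map_sub_count_restrict, Measure.restrict_apply measurableSet_ball, Measure.count_eq_zero_iff] at hvac
  by_contra hlt
  have hmem : q - p ∈ ball u s ∩ (fun z : E3 => z - p) '' S := by
    refine ⟨?_, q, hqS, rfl⟩
    rw [mem_ball, dist_eq_norm, show q - p - u = q - (p + u) by abel, ← dist_eq_norm]
    exact not_le.1 hlt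
  rw [hvac] at hmem
  exact hmem

/-- **THE POINTWISE VACANCY FLOOR OF A MINIMISING LAW.**  Granted the floor of item 9229 (`hU`): for a minimising point-stationary `δ`-hard-core
probability law, every offset `u` and radius `s > 0`, almost surely an `s`-vacant site `u` has Lennard-Jones field at least `e⋆` minus half the
root's short-range repulsion: `μ(B(u,s)) = 0 → e⋆ ≤ ∫ V_LJ(‖q − u‖) dμ + ½ ∫ V_LJ⁺(‖q‖) dμ`. [folklore] -/
theorem vacancyFloor_of_minimising
    (hU : ∀ δ' : ℝ, 0 < δ' → ∀ Q : Measure (Measure E3), IsProbabilityMeasure Q → (∀ᵐ μ ∂Q, IsRootedHardCore δ' μ) →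
      IsPointStationaryLaw Q → eStar ≤ ∫ μ, rootEnergy lennardJones μ ∂Q)
    (hδ : 0 < δ) [IsProbabilityMeasure P] (hcore : ∀ᵐ μ ∂P, IsRootedHardCore δ μ) (hstat : IsPointStationaryLaw P)
    (hE : ∫ μ, rootEnergy lennardJones μ ∂P ≤ eStar) (u : E3) {s : ℝ} (hs : 0 < s) :
    ∀ᵐ μ ∂P, μ (ball u s) = 0 →
      eStar ≤ (∫ z, lennardJones ‖z - u‖ ∂μ) + (∫ z, max (lennardJones ‖z‖) 0 ∂μ) / 2 := by
  classical
  -- `ofReal (max x 0) = ofReal x` (also in the tree as `UnimodularEnergy.ofReal_max_zero`; inlined to keep the import cone small)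
  have hmax : ∀ x : ℝ, ENNReal.ofReal (max x 0) = ENNReal.ofReal x := fun x => by
    rcases le_total x 0 with h | h
    · rw [max_eq_right h, ENNReal.ofReal_zero, ENNReal.ofReal_of_nonpos h]
    · rw [max_eq_left h]
  obtain ⟨hp, hm⟩ := measurable_ofReal_lennardJones_parts
  have hLJm : Measurable fun y : E3 => lennardJones ‖y‖ := by
    have : Measurable lennardJones := by unfold lennardJones; fun_prop
    exact this.comp measurable_norm
  -- measurable versions of the field at `u` and of the repulsion
  set Φt : Measure E3 → ℝ := fun μ =>
    (∫⁻ z, ENNReal.ofReal (lennardJones ‖z - u‖) ∂μ).toReal - (∫⁻ z, ENNReal.ofReal (-lennardJones ‖z - u‖) ∂μ).toReal with hΦt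
  set Rt : Measure E3 → ℝ := fun μ => (∫⁻ z, ENNReal.ofReal (lennardJones ‖z‖) ∂μ).toReal with hRt
  have hΦtm : Measurable Φt :=
    (Measure.measurable_lintegral (hp.comp (measurable_sub_const u))).ennreal_toReal.sub
      (Measure.measurable_lintegral (hm.comp (measurable_sub_const u))).ennreal_toReal
  have hRtm : Measurable Rt := (Measure.measurable_lintegral hp).ennreal_toReal
  -- the pattern: vacant AND deep
  set A : Set (Measure E3) := {μ | μ (ball u s) = 0} ∩ {μ | Φt μ + Rt μ / 2 < eStar} with hAdef
  have hA : MeasurableSet A :=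
    ((Measure.measurable_coe measurableSet_ball) (measurableSet_singleton 0)).inter
      (measurableSet_lt (hΦtm.add (hRtm.div_const 2)) measurable_const)
  -- the inserted sites are `s`-vacant, surely on hard-core configurations
  have hV : ∀ᵐ μ ∂P, ∀ p q : E3, μ {p} ≠ 0 → μ {q} ≠ 0 → μ.map (fun x : E3 => x - p) ∈ A → s ≤ dist q (p + u) := by
    filter_upwards [hcore] with μ hμ p q _ hq hpA
    exact le_dist_of_vacant hμ hq hpA.1
  -- the symmetrised insertion price for this pattern
  obtain ⟨hintM, hprice⟩ := meanField_ge_of_minimising hU hδ hs hcore hstat hA u hV hE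
  obtain ⟨hintΦ, -, -⟩ := integral_crossField_eq hδ hs hcore hstat hA u hV
  obtain ⟨I, -, hI⟩ := exists_measurable_ins (A := A) hδ hA u
  -- on `A`: the identification with the measurable versions and the domination of the mutual term by the repulsion
  have hptw : ∀ᵐ μ ∂(P.restrict A),
      (∫ z, lennardJones ‖z - u‖ ∂μ) + (∫ z, lennardJones ‖z‖ ∂(μ.restrict {p : E3 | μ.map (fun x : E3 => x - p) ∈ A})) / 2 ≤
        Φt μ + Rt μ / 2 := by
    filter_upwards [ae_restrict_of_ae (s := A) hcore, ae_restrict_of_ae (s := A) hV, ae_restrict_mem hA] with μ hμ hμV hμA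
    obtain ⟨hintv, hintK, -⟩ := rootEnergy_ins_copy hδ hs hμ (hI μ hμ).1 hμV hμA
    have hintμ : Integrable (fun z : E3 => lennardJones ‖z‖) μ := integrable_lennardJones_of_hardCore hδ hμ
    have e1 : ∫ z, lennardJones ‖z - u‖ ∂μ = Φt μ := integral_eq_lintegral_pos_part_sub_lintegral_neg_part hintv
    have e2 : ∫ z, max (lennardJones ‖z‖) 0 ∂μ = Rt μ := by
      rw [integral_eq_lintegral_of_nonneg_ae (Filter.Eventually.of_forall fun z => (le_max_right _ _ : (0 : ℝ) ≤ max (lennardJones ‖z‖) 0))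
        (show Measurable (fun z : E3 => max (lennardJones ‖z‖) 0) from hLJm.max measurable_const).aestronglyMeasurable]
      simp only [hRt, hmax]
    have e3 : ∫ z, lennardJones ‖z‖ ∂(μ.restrict {p : E3 | μ.map (fun x : E3 => x - p) ∈ A}) ≤ ∫ z, max (lennardJones ‖z‖) 0 ∂μ :=
      calc ∫ z, lennardJones ‖z‖ ∂(μ.restrict {p : E3 | μ.map (fun x : E3 => x - p) ∈ A})
          ≤ ∫ z, max (lennardJones ‖z‖) 0 ∂(μ.restrict {p : E3 | μ.map (fun x : E3 => x - p) ∈ A}) :=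
            integral_mono hintK (hintμ.pos_part.mono_measure Measure.restrict_le_self) fun z => le_max_left _ _
        _ ≤ ∫ z, max (lennardJones ‖z‖) 0 ∂μ :=
            setIntegral_le_integral hintμ.pos_part (Filter.Eventually.of_forall fun z => le_max_right _ _)
    rw [e1, ← e2]
    linarith
  have hlt : ∀ᵐ μ ∂(P.restrict A), Φt μ + Rt μ / 2 < eStar := by
    filter_upwards [ae_restrict_mem hA] with μ hμA
    exact hμA.2
  -- integrability on `P|A`
  have hintΦA : Integrable (fun μ => ∫ z, lennardJones ‖z - u‖ ∂μ) (P.restrict A) := by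
    refine (hintΦ.restrict (s := A)).congr ?_
    filter_upwards [ae_restrict_mem hA] with μ hμA
    simp only [Set.indicator_of_mem hμA]
  have hsum : (P A).toReal * eStar ≤ ∫ μ in A, ((∫ z, lennardJones ‖z - u‖ ∂μ) +
      (∫ z, lennardJones ‖z‖ ∂(μ.restrict {p : E3 | μ.map (fun x : E3 => x - p) ∈ A})) / 2) ∂P := by
    rw [integral_add hintΦA (hintM.div_const 2), integral_div]
    exact hprice
  -- hence `P(A) = 0`: on `A` the integrand is a.s. `< e⋆`, so its integral over a set of positive mass would be `< P(A)·e⋆`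
  have hPA : P A = 0 := by
    by_contra hne
    have hlt' : ∀ᵐ μ ∂(P.restrict A), (∫ z, lennardJones ‖z - u‖ ∂μ) +
        (∫ z, lennardJones ‖z‖ ∂(μ.restrict {p : E3 | μ.map (fun x : E3 => x - p) ∈ A})) / 2 < eStar := by
      filter_upwards [hptw, hlt] with μ h1 h2
      exact lt_of_le_of_lt h1 h2
    have hintF : Integrable (fun μ => (∫ z, lennardJones ‖z - u‖ ∂μ) +
        (∫ z, lennardJones ‖z‖ ∂(μ.restrict {p : E3 | μ.map (fun x : E3 => x - p) ∈ A})) / 2) (P.restrict A) :=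
      hintΦA.add (hintM.div_const 2)
    have h2 : ∫ μ in A, ((∫ z, lennardJones ‖z - u‖ ∂μ) +
        (∫ z, lennardJones ‖z‖ ∂(μ.restrict {p : E3 | μ.map (fun x : E3 => x - p) ∈ A})) / 2) ∂P < ∫ _μ in A, eStar ∂P := by
      rw [← sub_pos, ← integral_sub (integrable_const _) hintF]
      refine (integral_pos_iff_support_of_nonneg_ae (μ := P.restrict A) (f := fun μ => eStar - ((∫ z, lennardJones ‖z - u‖ ∂μ) +
        (∫ z, lennardJones ‖z‖ ∂(μ.restrict {p : E3 | μ.map (fun x : E3 => x - p) ∈ A})) / 2)) ?_ ((integrable_const _).sub hintF)).2 ?_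
      · filter_upwards [hlt'] with μ h
        exact sub_nonneg.2 h.le
      · have hsupp : ∀ᵐ μ ∂(P.restrict A), μ ∈ Function.support fun μ => eStar - ((∫ z, lennardJones ‖z - u‖ ∂μ) +
            (∫ z, lennardJones ‖z‖ ∂(μ.restrict {p : E3 | μ.map (fun x : E3 => x - p) ∈ A})) / 2) := by
          filter_upwards [hlt'] with μ h
          rw [Function.mem_support]
          exact (sub_pos.2 h).ne'
        rw [ae_iff] at hsupp
        by_contra hle
        have h0 := le_antisymm (not_lt.1 hle) bot_le
        have : (P.restrict A) univ = 0 := by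
          refine le_antisymm ?_ bot_le
          calc (P.restrict A) univ ≤ (P.restrict A) (Function.support fun μ => eStar - ((∫ z, lennardJones ‖z - u‖ ∂μ) +
                  (∫ z, lennardJones ‖z‖ ∂(μ.restrict {p : E3 | μ.map (fun x : E3 => x - p) ∈ A})) / 2)) +
                (P.restrict A) {μ | ¬μ ∈ Function.support fun μ => eStar - ((∫ z, lennardJones ‖z - u‖ ∂μ) +
                  (∫ z, lennardJones ‖z‖ ∂(μ.restrict {p : E3 | μ.map (fun x : E3 => x - p) ∈ A})) / 2)} := by
                  rw [← Set.union_compl_self (Function.support fun μ => eStar - ((∫ z, lennardJones ‖z - u‖ ∂μ) +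
                    (∫ z, lennardJones ‖z‖ ∂(μ.restrict {p : E3 | μ.map (fun x : E3 => x - p) ∈ A})) / 2))]
                  exact measure_union_le _ _
            _ = 0 := by rw [h0, hsupp, add_zero]
        rw [Measure.restrict_apply_univ] at this
        exact hne this
    rw [setIntegral_const, smul_eq_mul] at h2
    have h3 : P.real A = (P A).toReal := rfl
    rw [h3] at h2
    linarith [hsum, h2]
  -- conclusion: almost surely the root is not in `A`
  have hnot : ∀ᵐ μ ∂P, μ ∉ A := (measure_eq_zero_iff_ae_notMem.1 hPA)
  filter_upwards [hcore, hnot, hV] with μ hμ hμA hμV hvac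
  have hge : eStar ≤ Φt μ + Rt μ / 2 := by
    by_contra hlt'
    exact hμA ⟨hvac, not_le.1 hlt'⟩
  -- identify the measurable versions on this vacant hard-core configuration
  have hμ' := hμ
  obtain ⟨S, h0S, hsep, rfl⟩ := hμ
  have hsep' : ∀ x ∈ insert u S, ∀ y ∈ insert u S, x ≠ y → min δ s ≤ dist x y := by
    have hfar : ∀ q ∈ S, s ≤ dist q u := fun q hq => by
      have := le_dist_of_vacant (p := 0) hμ' ((count_restrict_singleton_ne_zero_iff S q).2 hq) (by simpa using hvac)
      simpa using this
    intro x hx y hy hxy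
    rcases hx with rfl | hx <;> rcases hy with rfl | hy
    · exact absurd rfl hxy
    · rw [dist_comm]; exact (min_le_right _ _).trans (hfar y hy)
    · exact (min_le_right _ _).trans (hfar x hx)
    · exact (min_le_left _ _).trans (hsep x hx y hy hxy)
  have hins : IsRootedHardCore (min δ s) ((Measure.count : Measure E3).restrict (insert u S)) :=
    ⟨insert u S, Set.mem_insert_of_mem u h0S, hsep', rfl⟩
  have hθ : IsRootedHardCore (min δ s) (((Measure.count : Measure E3).restrict (insert u S)).map fun x : E3 => x - u) :=
    hins.map_sub ((count_restrict_singleton_ne_zero_iff _ u).2 (Set.mem_insert u S))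
  have hintv' : Integrable (fun z : E3 => lennardJones ‖z‖) (((Measure.count : Measure E3).restrict (insert u S)).map fun x : E3 => x - u) :=
    integrable_lennardJones_of_hardCore (lt_min hδ hs) hθ
  have hintv : Integrable (fun z : E3 => lennardJones ‖z - u‖) ((Measure.count : Measure E3).restrict S) :=
    ((integrable_map_measure hLJm.aestronglyMeasurable (measurable_sub_const u).aemeasurable).1 hintv').mono_measure
      (Measure.restrict_mono (Set.subset_insert u S) le_rfl)
  have e1 : ∫ z, lennardJones ‖z - u‖ ∂((Measure.count : Measure E3).restrict S) = Φt ((Measure.count : Measure E3).restrict S) :=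
    integral_eq_lintegral_pos_part_sub_lintegral_neg_part hintv
  have e2 : ∫ z, max (lennardJones ‖z‖) 0 ∂((Measure.count : Measure E3).restrict S) = Rt ((Measure.count : Measure E3).restrict S) := by
    rw [integral_eq_lintegral_of_nonneg_ae (Filter.Eventually.of_forall fun z => (le_max_right _ _ : (0 : ℝ) ≤ max (lennardJones ‖z‖) 0))
      (show Measurable (fun z : E3 => max (lennardJones ‖z‖) 0) from hLJm.max measurable_const).aestronglyMeasurable]
    simp only [hRt, hmax]
  rw [e1, e2]
  exact hge

/-- Hard-core configurations are locally finite on the norm shells (the carrier hypothesis of the Aldous–Lyons transfer). [folklore] -/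
theorem ae_shellFinite_of_hardCore (hδ : 0 < δ) (hcore : ∀ᵐ μ ∂P, IsRootedHardCore δ μ) :
    ∀ᵐ μ ∂P, ∀ n : ℕ, μ ((fun z : E3 => ⌊‖z‖⌋₊) ⁻¹' {n}) < ∞ := by
  filter_upwards [hcore] with μ hμ n
  obtain ⟨S, h0, hsep, rfl⟩ := hμ
  have hsub : (fun z : E3 => ⌊‖z‖⌋₊) ⁻¹' {n} ∩ S ⊆ closedBall (0 : E3) (n + 1) ∩ S := by
    rintro z ⟨hz, hzS⟩
    refine ⟨mem_closedBall.2 ?_, hzS⟩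
    rw [dist_zero_right]
    have h1 : (⌊‖z‖⌋₊ : ℝ) = n := by exact_mod_cast hz
    have h2 := Nat.lt_floor_add_one ‖z‖
    rw [h1] at h2
    exact h2.le
  have hfin : ((fun z : E3 => ⌊‖z‖⌋₊) ⁻¹' {n} ∩ S).Finite :=
    (finite_inter_of_separated hδ hsep (isCompact_closedBall (0 : E3) (n + 1))).subset hsub
  have hmeas : Measurable (fun z : E3 => ⌊‖z‖⌋₊) := Nat.measurable_floor.comp measurable_norm
  rw [Measure.restrict_apply (hmeas (measurableSet_singleton n))]
  exact Measure.count_apply_lt_top.2 hfin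

/-- **THE VACANCY FLOOR AT EVERY ATOM, ALL RATIONAL HOLES AT ONCE.**  Granted the floor of item 9229: for a minimising point-stationary
`δ`-hard-core probability law, almost surely, for EVERY atom `y` of the configuration, every rational offset `v` and every rational radius
`r > 0`: if the site `y + v` is `r`-vacant then, seen from `y` (`θ_y μ = μ.map (· − y)`),
`e⋆ ≤ ∫ V_LJ(‖z − v‖) d(θ_y μ) + ½ ∫ V_LJ⁺(‖z‖) d(θ_y μ)` — the hole at `y + v` is at most `e⋆`-deep up to half the anchor's short-range repulsion.
In particular every hole of the configuration has field `≥ e⋆ − ½ inf_y R_y(μ)` over all anchoring atoms `y`. [folklore] -/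
theorem ae_forall_vacancyFloor_of_minimising
    (hU : ∀ δ' : ℝ, 0 < δ' → ∀ Q : Measure (Measure E3), IsProbabilityMeasure Q → (∀ᵐ μ ∂Q, IsRootedHardCore δ' μ) →
      IsPointStationaryLaw Q → eStar ≤ ∫ μ, rootEnergy lennardJones μ ∂Q)
    (hδ : 0 < δ) [IsProbabilityMeasure P] (hcore : ∀ᵐ μ ∂P, IsRootedHardCore δ μ) (hstat : IsPointStationaryLaw P)
    (hE : ∫ μ, rootEnergy lennardJones μ ∂P ≤ eStar) :
    ∀ᵐ μ ∂P, ∀ y : E3, μ {y} ≠ 0 → ∀ v : Fin 3 → ℚ, ∀ r : ℚ, 0 < (r : ℝ) →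
      (μ.map fun z : E3 => z - y) (ball ((EuclideanSpace.equiv (Fin 3) ℝ).symm fun c => (v c : ℝ)) r) = 0 →
        eStar ≤ (∫ z, lennardJones ‖z - (EuclideanSpace.equiv (Fin 3) ℝ).symm (fun c => (v c : ℝ))‖ ∂(μ.map fun z : E3 => z - y)) +
          (∫ z, max (lennardJones ‖z‖) 0 ∂(μ.map fun z : E3 => z - y)) / 2 := by
  -- at the root, for all rational offsets and radii simultaneously
  have hroot : ∀ᵐ μ ∂P, ∀ v : Fin 3 → ℚ, ∀ r : ℚ, 0 < (r : ℝ) →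
      μ (ball ((EuclideanSpace.equiv (Fin 3) ℝ).symm fun c => (v c : ℝ)) r) = 0 →
        eStar ≤ (∫ z, lennardJones ‖z - (EuclideanSpace.equiv (Fin 3) ℝ).symm (fun c => (v c : ℝ))‖ ∂μ) +
          (∫ z, max (lennardJones ‖z‖) 0 ∂μ) / 2 := by
    rw [ae_all_iff]; intro v
    rw [ae_all_iff]; intro r
    by_cases hr : 0 < (r : ℝ)
    · filter_upwards [vacancyFloor_of_minimising hU hδ hcore hstat hE ((EuclideanSpace.equiv (Fin 3) ℝ).symm fun c => (v c : ℝ)) hr]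
        with μ hμ _ hvac
      exact hμ hvac
    · exact Filter.Eventually.of_forall fun μ h => absurd h hr
  -- everything shows at the root
  exact hstat.ae_forall_map_sub (ae_shellFinite_of_hardCore hδ hcore) hroot

end Summit.AtomisticToContinuum.Crystallization.Theorems.FrustratedLawDichotomyThickening

end
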